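import Summits.MatrixMultiplication.MatrixMultiplication.Theorems.FidelityWitnessesLinearDefectLawUnitSlope

/-!
# `FidelityWitnesses.LinearDefectLaw` (stmt-MatrixMultiplication-14039) — the exact `n = 2` content

What the law says at `n = 2` (tree: `R̲(⟨2,2,2⟩) = 7`, `algBorderRank_matMulTensor_two`) is `M(2,r) ≤ r + 1` for
every `r`.  This file pins down EXACTLY which of these rungs carry content, using only landed theorems of the line
`border-singular-values`:

* `r ≥ 7`: Cauchy–Schwarz (`eight_bounds_two`);
* `r ≤ 3`: the UNCONDITIONAL unit slope below the window (`slope_below_window`, p90464: `M(2,r+1) ≥ M(2,r) + 1` for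
  `r ≤ 3`) telescopes every rung `r ≤ 3` down from the rung `r = 4`;
* `r = 6`, `r = 5`, `r = 4`: the three window rungs — `SevenEighthsLaw` (stmt-4959, `M(2,6) ≤ 7`), `SixEighthsAtFive`
  (stmt-14040, `M(2,5) ≤ 6`) and the rank-4 rung `M(2,4) ≤ 5` ("five eighths at four"; numerically `M(2,4) = 4.4141`,
  the only window rung with slack; not filed as an item).

Hence `lawAtTwo_iff`: the `n = 2` instance of `LinearDefectLaw` is EQUIVALENT to the conjunction of these three rungs, and
`linearDefectLaw_two_content`: the item implies all three.  In particular no proof of the item can precede the open items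
stmt-4959 and stmt-14040, a refutation of either refutes the item in one line, and the residual `n = 2` statement beyond
them is exactly the rank-4 rung.
-/

noncomputable section

namespace Summit.MatrixMultiplication.MatrixMultiplication.Theorems.LinearDefectLaw.TwoIff

open scoped BigOperators
open Literature.Computability.AlgebraicComplexity
open Summit.MatrixMultiplication.MatrixMultiplication.Theses.FidelityWitnesses
  (LinearDefectLaw SevenEighthsLaw SixEighthsAtFive)
open Summit.MatrixMultiplication.MatrixMultiplication.Theorems.LinearDefectLaw.Reduction

set_option linter.dupNamespace false

/-- Reading of the `n = 2` instance of the law with the tree value `R̲(⟨2,2,2⟩) = 7`: `M(2,r) ≤ r + 1`, in the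
line's `overlap`/`normSq` vocabulary. -/
theorem lawAtTwo_iff_succ :
    (∀ r : ℕ, ∀ S : Fin 2 × Fin 2 → Fin 2 × Fin 2 → Fin 2 × Fin 2 → ℂ, tensorRank S ≤ r →
      ‖∑ a, ∑ b, ∑ c, S a b c * matMulTensor ℂ 2 2 2 a b c‖ ^ 2 ≤
        (((2 : ℕ) : ℝ) ^ 3 + (r : ℝ) - (algBorderRank (matMulTensor ℂ 2 2 2) : ℝ)) *
          ∑ a, ∑ b, ∑ c, ‖S a b c‖ ^ 2) ↔
    ∀ r : ℕ, ∀ S : P 2 → P 2 → P 2 → ℂ, tensorRank S ≤ r → ‖overlap S‖ ^ 2 ≤ ((r : ℝ) + 1) * normSq S := by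
  have e : ∀ r : ℕ, (((2 : ℕ) : ℝ) ^ 3 + (r : ℝ) - ((7 : ℕ) : ℝ)) = (r : ℝ) + 1 := by
    intro r; push_cast; ring
  constructor
  · intro h r S hS
    have key := h r S hS
    rw [algBorderRank_matMulTensor_two ℂ, e] at key
    exact key
  · intro h r S hS
    have key := h r S hS
    show _ ≤ (((2 : ℕ) : ℝ) ^ 3 + (r : ℝ) - (algBorderRank (matMulTensor ℂ 2 2 2) : ℝ)) * _
    rw [algBorderRank_matMulTensor_two ℂ, e]
    exact key

/-- Downward telescoping below the window: a bound `c` at level `r + 1 ≤ 4` gives `c − 1` at level `r`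
(`slope_below_window`, unconditional). -/
theorem rung_down {r : ℕ} (hr : r + 1 ≤ 4) {c : ℝ}
    (hc : ∀ S : P 2 → P 2 → P 2 → ℂ, tensorRank S ≤ r + 1 → ‖overlap S‖ ^ 2 ≤ c * normSq S) :
    ∀ S : P 2 → P 2 → P 2 → ℂ, tensorRank S ≤ r → ‖overlap S‖ ^ 2 ≤ (c - 1) * normSq S :=
  slope_below_window 2 r le_rfl hr c hc

/-- **The exact `n = 2` content of the law.** The `n = 2` instance of `LinearDefectLaw` (its body at `n = 2`, verbatim)
is equivalent to `SevenEighthsLaw ∧ SixEighthsAtFive ∧ (M(2,4) ≤ 5)`, the last conjunct being the rank-4 rung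
`|⟨S,⟨2,2,2⟩⟩|² ≤ 5‖S‖²` for every `S` of rank `≤ 4`. -/
theorem lawAtTwo_iff :
    (∀ r : ℕ, ∀ S : Fin 2 × Fin 2 → Fin 2 × Fin 2 → Fin 2 × Fin 2 → ℂ, tensorRank S ≤ r →
      ‖∑ a, ∑ b, ∑ c, S a b c * matMulTensor ℂ 2 2 2 a b c‖ ^ 2 ≤
        (((2 : ℕ) : ℝ) ^ 3 + (r : ℝ) - (algBorderRank (matMulTensor ℂ 2 2 2) : ℝ)) *
          ∑ a, ∑ b, ∑ c, ‖S a b c‖ ^ 2) ↔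
    SevenEighthsLaw ∧ SixEighthsAtFive ∧
      ∀ S : Fin 2 × Fin 2 → Fin 2 × Fin 2 → Fin 2 × Fin 2 → ℂ, tensorRank S ≤ 4 →
        ‖∑ a, ∑ b, ∑ c, S a b c * matMulTensor ℂ 2 2 2 a b c‖ ^ 2 ≤ 5 * ∑ a, ∑ b, ∑ c, ‖S a b c‖ ^ 2 := by
  rw [lawAtTwo_iff_succ]
  constructor
  · intro h
    refine ⟨fun S hS => ?_, fun S hS => ?_, fun S hS => ?_⟩
    · have key := h 6 S hS; norm_num at key; exact key
    · have key := h 5 S hS; norm_num at key; exact key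
    · have key := h 4 S hS; norm_num at key; exact key
  · rintro ⟨h6, h5, h4⟩
    -- the three window rungs in `overlap`/`normSq` form
    have r6 : ∀ S : P 2 → P 2 → P 2 → ℂ, tensorRank S ≤ 6 → ‖overlap S‖ ^ 2 ≤ 7 * normSq S :=
      fun S hS => h6 S hS
    have r5 : ∀ S : P 2 → P 2 → P 2 → ℂ, tensorRank S ≤ 5 → ‖overlap S‖ ^ 2 ≤ 6 * normSq S :=
      fun S hS => h5 S hS
    have r4 : ∀ S : P 2 → P 2 → P 2 → ℂ, tensorRank S ≤ 4 → ‖overlap S‖ ^ 2 ≤ 5 * normSq S :=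
      fun S hS => h4 S hS
    -- below the window: unconditional telescoping
    have r3 : ∀ S : P 2 → P 2 → P 2 → ℂ, tensorRank S ≤ 3 → ‖overlap S‖ ^ 2 ≤ 4 * normSq S := by
      intro S hS; have key := rung_down (r := 3) le_rfl r4 S hS; norm_num at key; exact key
    have r2 : ∀ S : P 2 → P 2 → P 2 → ℂ, tensorRank S ≤ 2 → ‖overlap S‖ ^ 2 ≤ 3 * normSq S := by
      intro S hS; have key := rung_down (r := 2) (by norm_num) r3 S hS; norm_num at key; exact key
    have r1 : ∀ S : P 2 → P 2 → P 2 → ℂ, tensorRank S ≤ 1 → ‖overlap S‖ ^ 2 ≤ 2 * normSq S := by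
      intro S hS; have key := rung_down (r := 1) (by norm_num) r2 S hS; norm_num at key; exact key
    have r0 : ∀ S : P 2 → P 2 → P 2 → ℂ, tensorRank S ≤ 0 → ‖overlap S‖ ^ 2 ≤ 1 * normSq S := by
      intro S hS; have key := rung_down (r := 0) (by norm_num) r1 S hS; norm_num at key ⊢; exact key
    intro r S hS
    rcases Nat.lt_or_ge r 7 with hr | hr
    · interval_cases r
      · simpa using r0 S hS
      · have := r1 S hS; norm_num; exact this
      · have := r2 S hS; norm_num; exact this
      · have := r3 S hS; norm_num; exact this
      · have := r4 S hS; norm_num; exact this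
      · have := r5 S hS; norm_num; exact this
      · have := r6 S hS; norm_num; exact this
    · -- `r ≥ 7`: Cauchy–Schwarz, `8 ≤ r + 1`
      have h8 := eight_bounds_two r S hS
      have hr' : (8 : ℝ) ≤ (r : ℝ) + 1 := by exact_mod_cast Nat.succ_le_succ hr
      exact h8.trans (mul_le_mul_of_nonneg_right hr' (normSq_nonneg S))

/-- **Corollary.** The item implies the three `n = 2` rungs `M(2,6) ≤ 7`, `M(2,5) ≤ 6`, `M(2,4) ≤ 5`; in particular it
cannot close before the open items `SevenEighthsLaw` (stmt-4959) and `SixEighthsAtFive` (stmt-14040), and a refutation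
of either one (or of the rank-4 rung) refutes it. -/
theorem linearDefectLaw_two_content (h : LinearDefectLaw) :
    SevenEighthsLaw ∧ SixEighthsAtFive ∧
      ∀ S : Fin 2 × Fin 2 → Fin 2 × Fin 2 → Fin 2 × Fin 2 → ℂ, tensorRank S ≤ 4 →
        ‖∑ a, ∑ b, ∑ c, S a b c * matMulTensor ℂ 2 2 2 a b c‖ ^ 2 ≤ 5 * ∑ a, ∑ b, ∑ c, ‖S a b c‖ ^ 2 :=
  lawAtTwo_iff.1 fun r S hS => h 2 r S hS

/-- **Converse at `n = 2`.** The three rungs give back the whole `n = 2` instance of the law (every `r`). -/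
theorem lawAtTwo_of_rungs (h6 : SevenEighthsLaw) (h5 : SixEighthsAtFive)
    (h4 : ∀ S : Fin 2 × Fin 2 → Fin 2 × Fin 2 → Fin 2 × Fin 2 → ℂ, tensorRank S ≤ 4 →
      ‖∑ a, ∑ b, ∑ c, S a b c * matMulTensor ℂ 2 2 2 a b c‖ ^ 2 ≤ 5 * ∑ a, ∑ b, ∑ c, ‖S a b c‖ ^ 2)
    (r : ℕ) (S : Fin 2 × Fin 2 → Fin 2 × Fin 2 → Fin 2 × Fin 2 → ℂ) (hS : tensorRank S ≤ r) :
    ‖∑ a, ∑ b, ∑ c, S a b c * matMulTensor ℂ 2 2 2 a b c‖ ^ 2 ≤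
      (((2 : ℕ) : ℝ) ^ 3 + (r : ℝ) - (algBorderRank (matMulTensor ℂ 2 2 2) : ℝ)) *
        ∑ a, ∑ b, ∑ c, ‖S a b c‖ ^ 2 :=
  lawAtTwo_iff.2 ⟨h6, h5, h4⟩ r S hS

/-- **Registered stub `stub_lawAtTwoIff`** (raw form of `lawAtTwo_iff`): the exact `n = 2` content of the item. -/
theorem stub_lawAtTwoIff : (∀ r : ℕ, ∀ S : Fin 2 × Fin 2 → Fin 2 × Fin 2 → Fin 2 × Fin 2 → ℂ, tensorRank S ≤ r → ‖∑ a, ∑ b, ∑ c, S a b c * matMulTensor ℂ 2 2 2 a b c‖ ^ 2 ≤ (((2 : ℕ) : ℝ) ^ 3 + (r : ℝ) - (algBorderRank (matMulTensor ℂ 2 2 2) : ℝ)) * ∑ a, ∑ b, ∑ c, ‖S a b c‖ ^ 2) ↔ Summit.MatrixMultiplication.MatrixMultiplication.Theses.FidelityWitnesses.SevenEighthsLaw ∧ Summit.MatrixMultiplication.MatrixMultiplication.Theses.FidelityWitnesses.SixEighthsAtFive ∧ ∀ S : Fin 2 × Fin 2 → Fin 2 × Fin 2 → Fin 2 × Fin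 2 → ℂ, tensorRank S ≤ 4 → ‖∑ a, ∑ b, ∑ c, S a b c * matMulTensor ℂ 2 2 2 a b c‖ ^ 2 ≤ 5 * ∑ a, ∑ b, ∑ c, ‖S a b c‖ ^ 2 :=
  lawAtTwo_iff

end Summit.MatrixMultiplication.MatrixMultiplication.Theorems.LinearDefectLaw.TwoIff

end
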